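import Literature.MathematicalPhysics.QuantumFieldTheory.Balaban1983to89.B11Eq44COperatorTorus
import Literature.MathematicalPhysics.QuantumFieldTheory.Balaban1983to89.B7Eq123BackgroundModulus
import Literature.MathematicalPhysics.QuantumFieldTheory.Balaban1983to89.B11Eq117LetterDefects

/-!
# `Balaban1983to89.B11Eq44COperatorModulus` — T. Bałaban, *The variational problem and background fields in renormalization group method for
# lattice gauge theories*, Commun. Math. Phys. **102** (1985) 277–309 [Balaban1985Variational] Sect. C p. 285 (44), with [Balaban1985Averaging] (122)–(123)
# p. 36, Proposition 7 p. 43: THE BACKGROUND MODULUS OF THE SECT. C LETTER `C(U)` (`B11Eq44COperatorTorus.Cc`) AT THE FLAT POINT, IN THE NORMS OF (115) —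
# `‖C(U)P − C(1)(ιP)‖_(−0) ≤ K_C·ε·‖P‖_(115)` on a ball, for unit-bounded small-bond backgrounds of a fixed lattice

statement-level skeleton of published theorems with citation tags; proofs where landed; nothing here is a claim about the Yang–Mills mass gap

PDF held: `paper:balaban1985-cmp102-variational-background` p. 285 (44) *«Q_j(ηA) = LʲηQ_jA + C_j(LʲηA), |C_j(LʲηA)| ≦ C₂(Lʲη)²|A|²»* (via `B11Eq44COperatorTorus`);
[Balaban1985Averaging] Prop. 7 p. 43 (analyticity in the background; via `B7Eq123BackgroundModulus`).

WHY THIS FILE (cell context).  The NE9 chain's `Support/NE9CurChartLipschitzAtFlat.cur_chart_lipschitz_at_flat_of_small_bonds` (owner gen 82) displays the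
modulus `δ_C` of `Cc` on a ball: `∀ P, ‖P‖ < r_C → ‖Cc_U P − Cc_1 (ιP)‖ ≤ δ_C`.  `B7Eq123BackgroundModulus.norm_Ccov_sub_flat_le` (gen 82) gives the `ℤ^d`-level modulus of
`Ccov`; this file reads it on the torus carriers of (115): `Cc`'s block values are `Cblock … = Ccov` at the periodic extensions (`Cblock_apply`), the jet identity does not change
the underlying configuration (`jetId_apply`), the sup of the configuration is `≤ w̲₀⁻¹‖P‖` and the block-field size `|·|_(−0)` is `≤ w̄_B·sup`.

WHAT IS PROVED (sorry-free; 0 def; no inequality of the papers asserted).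
* **`norm_Cc_sub_flat_le`** — for `U(b) ∈ U1`, `‖U(b) − 1‖ ≤ ε ≤ 1∕(12288N)` (`N = (2d+2)L`), `0 ≤ η`, and `P : Space115 … (∇_U)` with
  `η·w̲₀⁻¹·‖P‖ ≤ c₃(d,L)∕4`: `‖Cc_U P − Cc_1 (ι_{∇_U→∇_1}P)‖ ≤ w̄_B·(75497472(d+1)LN + 102(d+1)²L²)·ε·η·w̲₀⁻¹·‖P‖`.
* **`exists_Cc_modulus_at_flat`** — packaged: `∃ K_C r_C > 0, ∀ U` (U1, `‖U(b) − 1‖ ≤ ε ≤ 1∕(12288N)`) `∀ P, ‖P‖ < r_C → ‖Cc_U P − Cc_1(ιP)‖ ≤ K_C·ε·‖P‖`.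
MODEL / HONEST SCOPE.  Fixed lattice; crude constants; first order at the flat point only; NOT summit progress (cell pub-balaban: NE9 NOT PRINTED / NOT PROVED; spine
PROVED 0/9).  Filed by the pub-balaban NE9 BINDER-row owner lineage `b2b-balaban-t4-ne9-p1` (gen 82); NEW file importing `B11Eq44COperatorTorus`, `B7Eq123BackgroundModulus`,
`B11Eq117LetterDefects` only; nothing modified.  Net new unproved facts: 0.
-/

noncomputable section

namespace Literature.MathematicalPhysics.QuantumFieldTheory.Balaban1983to89.B11Eq44COperatorModulus

open Metric Set
open B11Eq115Space B11Eq111FrakG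
open B9SectCLatticeCarrier (Bond)
open B4Sect5Torus (TSite)
open B7Prop1Explicit (U1)
open B9Eq319QprimeTorus (fineP)
open B9Eq315QTorus (perCfg cornerSite)
open B11Eq44COperatorTorus (Cc Cblock Cblock_apply equiv_Cc_apply)
open B7Eq123BackgroundModulus (norm_Ccov_sub_flat_le)
open B11Eq117LetterDefects (jetId_apply)
open B7Prop3Flat (c3)

variable {d : ℕ} (L : ℕ) (m : Fin d → ℕ) [∀ i, NeZero (fineP L m i)]
  {𝔸 : Type*} [NormedRing 𝔸] [NormedAlgebra ℂ 𝔸] [CompleteSpace 𝔸] [NormOneClass 𝔸] [FiniteDimensional ℂ 𝔸]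
  {η : ℝ} [Fact (0 < (L : ℝ))] [Fact (0 < η)] (lev₀ : Bond d (fineP L m) → ℕ) (lev₁ : Bond d (fineP L m) × Fin d → ℕ)
  (levB : Bond d m → ℕ)

/-- **THE BACKGROUND MODULUS OF `C(U)` AT THE FLAT POINT IN THE NORMS OF (115)**: `‖Cc_U P − Cc_1 (ι_{∇_U→∇_1}P)‖_(−0) ≤ w̄_B·K′·ε·η·w̲₀⁻¹·‖P‖` with
`K′ = 75497472(d+1)L·N + 102(d+1)²L²`, for `U(b) ∈ U1`, `‖U(b) − 1‖ ≤ ε ≤ 1∕(12288N)` and `η·w̲₀⁻¹·‖P‖ ≤ c₃(d,L)∕4` (block values = `Ccov` at the periodic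
extensions of `U` and of `η·P`; `B7Eq123BackgroundModulus.norm_Ccov_sub_flat_le` blockwise).
[cite: Balaban1985Variational, (44) p.285; Balaban1985Averaging, (122)–(123) p.36, Proposition 7 p.43] -/
theorem norm_Cc_sub_flat_le (hL : 1 ≤ L) (U : Bond d (fineP L m) → 𝔸ˣ) (hU : ∀ b, U b ∈ U1 𝔸) {ε : ℝ} (hε : 0 ≤ ε)
    (hεmax : ε ≤ 1 / (12288 * ((2 * (d * L) + L + L : ℕ) : ℝ))) (hUε : ∀ b, ‖(U b : 𝔸) - 1‖ ≤ ε)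
    (P : Space115 (L : ℝ) η lev₀ lev₁ (nabla115 η U))
    (hP : η * (NegSup.wInvSup (levWeight (L : ℝ) η lev₀ 1) * ‖P‖) ≤ c3 d L / 4) :
    ‖Cc L m η U lev₀ lev₁ (nabla115 η U) levB P -
        Cc L m η (fun _ : Bond d (fineP L m) => (1 : 𝔸ˣ)) lev₀ lev₁ (nabla115 η fun _ => 1) levB
          (LinearMap.toContinuousLinearMap
            ((jetLinearEquiv (L : ℝ) η lev₀ lev₁ (nabla115 η (fun _ : Bond d (fineP L m) => (1 : 𝔸ˣ)))).symm.toLinearMap ∘ₗ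
              (jetLinearEquiv (L : ℝ) η lev₀ lev₁ (nabla115 η U)).toLinearMap) P)‖ ≤
      (NegSup.wSup (levWeight (L : ℝ) η levB 0) : ℝ) *
        ((75497472 * ((d : ℝ) + 1) * L * ((2 * (d * L) + L + L : ℕ) : ℝ) + 102 * ((d : ℝ) + 1) ^ 2 * L * L) * ε *
          (η * (NegSup.wInvSup (levWeight (L : ℝ) η lev₀ 1) * ‖P‖))) := by
  have hη : 0 ≤ η := (Fact.out : 0 < η).le
  set g : Bond d (fineP L m) → 𝔸 := JetSup.equiv _ _ (nabla115 η U) P with hg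
  -- the sup of the configuration against the (115) norm
  have hg1 : ‖g‖ ≤ NegSup.wInvSup (levWeight (L : ℝ) η lev₀ 1) * ‖P‖ := by
    have h := NegSup.sup_norm_le_wInvSup_mul (JetSup.fst P)
    rw [JetSup.equiv_fst] at h
    exact h.trans (mul_le_mul_of_nonneg_left (JetSup.norm_fst_le P) (NegSup.wInvSup (levWeight (L : ℝ) η lev₀ 1)).coe_nonneg)
  set a : ℝ := η * (NegSup.wInvSup (levWeight (L : ℝ) η lev₀ 1) * ‖P‖) with ha
  have ha0 : 0 ≤ a := by rw [ha]; positivity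
  have hA : ∀ (x : B7Prop1Explicit.Site d) (κ : Fin d), ‖perCfg (fineP L m) ((η : ℂ) • g) x κ‖ ≤ a := fun x κ => by
    rw [B9Eq315QTorus.perCfg_apply, Pi.smul_apply, norm_smul, Complex.norm_real, Real.norm_of_nonneg hη, ha]
    exact mul_le_mul_of_nonneg_left ((norm_le_pi_norm g _).trans hg1) hη
  -- blockwise: the difference of the block values is the `Ccov` difference at the periodic extensions
  have hdiff : ∀ c : Bond d m,
      ‖NegSup.equiv (levWeight (L : ℝ) η levB 0) 𝔸
          (Cc L m η U lev₀ lev₁ (nabla115 η U) levB P -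
            Cc L m η (fun _ : Bond d (fineP L m) => (1 : 𝔸ˣ)) lev₀ lev₁ (nabla115 η fun _ => 1) levB
              (LinearMap.toContinuousLinearMap
                ((jetLinearEquiv (L : ℝ) η lev₀ lev₁ (nabla115 η (fun _ : Bond d (fineP L m) => (1 : 𝔸ˣ)))).symm.toLinearMap ∘ₗ
                  (jetLinearEquiv (L : ℝ) η lev₀ lev₁ (nabla115 η U)).toLinearMap) P)) c‖ ≤
        (75497472 * ((d : ℝ) + 1) * L * ((2 * (d * L) + L + L : ℕ) : ℝ) + 102 * ((d : ℝ) + 1) ^ 2 * L * L) * ε * a := fun c => by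
    have e : NegSup.equiv (levWeight (L : ℝ) η levB 0) 𝔸
          (Cc L m η U lev₀ lev₁ (nabla115 η U) levB P -
            Cc L m η (fun _ : Bond d (fineP L m) => (1 : 𝔸ˣ)) lev₀ lev₁ (nabla115 η fun _ => 1) levB
              (LinearMap.toContinuousLinearMap
                ((jetLinearEquiv (L : ℝ) η lev₀ lev₁ (nabla115 η (fun _ : Bond d (fineP L m) => (1 : 𝔸ˣ)))).symm.toLinearMap ∘ₗ
                  (jetLinearEquiv (L : ℝ) η lev₀ lev₁ (nabla115 η U)).toLinearMap) P)) c =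
        B7Prop3GeneralLinear.Ccov L (perCfg (fineP L m) U) (perCfg (fineP L m) ((η : ℂ) • g)) (cornerSite L c.1) c.2 -
          B7Prop3GeneralLinear.Ccov L (1 : B7Prop1Explicit.Site d → Fin d → 𝔸ˣ) (perCfg (fineP L m) ((η : ℂ) • g)) (cornerSite L c.1) c.2 := rfl
    rw [e]
    exact norm_Ccov_sub_flat_le hL (V := perCfg (fineP L m) U) (fun x κ => hU _) hε hεmax (fun x κ => hUε _) _ ha0 hA hP (cornerSite L c.1) c.2
  -- the block-field size `|·|_(−0)` against the sup of the block values
  have hK : 0 ≤ (75497472 * ((d : ℝ) + 1) * L * ((2 * (d * L) + L + L : ℕ) : ℝ) + 102 * ((d : ℝ) + 1) ^ 2 * L * L) * ε * a := by positivity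
  have hsup : ‖NegSup.equiv (levWeight (L : ℝ) η levB 0) 𝔸
          (Cc L m η U lev₀ lev₁ (nabla115 η U) levB P -
            Cc L m η (fun _ : Bond d (fineP L m) => (1 : 𝔸ˣ)) lev₀ lev₁ (nabla115 η fun _ => 1) levB
              (LinearMap.toContinuousLinearMap
                ((jetLinearEquiv (L : ℝ) η lev₀ lev₁ (nabla115 η (fun _ : Bond d (fineP L m) => (1 : 𝔸ˣ)))).symm.toLinearMap ∘ₗ
                  (jetLinearEquiv (L : ℝ) η lev₀ lev₁ (nabla115 η U)).toLinearMap) P))‖ ≤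
        (75497472 * ((d : ℝ) + 1) * L * ((2 * (d * L) + L + L : ℕ) : ℝ) + 102 * ((d : ℝ) + 1) ^ 2 * L * L) * ε * a :=
    (pi_norm_le_iff_of_nonneg hK).2 hdiff
  have hw := NegSup.norm_le_wSup_mul (w := levWeight (L : ℝ) η levB 0) (V := 𝔸)
    (Cc L m η U lev₀ lev₁ (nabla115 η U) levB P -
      Cc L m η (fun _ : Bond d (fineP L m) => (1 : 𝔸ˣ)) lev₀ lev₁ (nabla115 η fun _ => 1) levB
        (LinearMap.toContinuousLinearMap
          ((jetLinearEquiv (L : ℝ) η lev₀ lev₁ (nabla115 η (fun _ : Bond d (fineP L m) => (1 : 𝔸ˣ)))).symm.toLinearMap ∘ₗ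
            (jetLinearEquiv (L : ℝ) η lev₀ lev₁ (nabla115 η U)).toLinearMap) P))
  exact hw.trans (mul_le_mul_of_nonneg_left hsup (NegSup.wSup (levWeight (L : ℝ) η levB 0)).coe_nonneg)

/-- **PACKAGED**: `∃ K_C r_C > 0` such that for every unit-bounded background with `‖U(b) − 1‖ ≤ ε ≤ 1∕(12288N)` and every `P` with `‖P‖ < r_C`,
`‖Cc_U P − Cc_1(ι P)‖ ≤ K_C·ε·‖P‖` — the displayed `δ_C` of `Support/NE9CurChartLipschitzAtFlat` PRODUCED at the flat point (take `δ_C := K_C·ε·r_C`).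
[cite: Balaban1985Variational, (44) p.285; Balaban1985Averaging, Proposition 7 p.43] -/
theorem exists_Cc_modulus_at_flat (hL : 1 ≤ L) :
    ∃ KC rC : ℝ, 0 < KC ∧ 0 < rC ∧ ∀ (U : Bond d (fineP L m) → 𝔸ˣ) (hU : ∀ b, U b ∈ U1 𝔸) {ε : ℝ}, 0 ≤ ε →
      ε ≤ 1 / (12288 * ((2 * (d * L) + L + L : ℕ) : ℝ)) → (∀ b, ‖(U b : 𝔸) - 1‖ ≤ ε) →
      ∀ P : Space115 (L : ℝ) η lev₀ lev₁ (nabla115 η U), ‖P‖ < rC →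
        ‖Cc L m η U lev₀ lev₁ (nabla115 η U) levB P -
            Cc L m η (fun _ : Bond d (fineP L m) => (1 : 𝔸ˣ)) lev₀ lev₁ (nabla115 η fun _ => 1) levB
              (LinearMap.toContinuousLinearMap
                ((jetLinearEquiv (L : ℝ) η lev₀ lev₁ (nabla115 η (fun _ : Bond d (fineP L m) => (1 : 𝔸ˣ)))).symm.toLinearMap ∘ₗ
                  (jetLinearEquiv (L : ℝ) η lev₀ lev₁ (nabla115 η U)).toLinearMap) P)‖ ≤ KC * ε * ‖P‖ := by
  have hη : 0 < η := Fact.out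
  have hL0 : (0 : ℝ) < L := by exact_mod_cast hL
  have hc3 : 0 < c3 d L := B7Prop3Flat.c3_pos d hL
  obtain ⟨w, hwdef⟩ : ∃ w : ℝ, w = NegSup.wInvSup (levWeight (L : ℝ) η lev₀ 1) := ⟨_, rfl⟩
  have hw : 0 ≤ w := by rw [hwdef]; exact (NegSup.wInvSup (levWeight (L : ℝ) η lev₀ 1)).coe_nonneg
  refine ⟨(NegSup.wSup (levWeight (L : ℝ) η levB 0) : ℝ) *
      ((75497472 * ((d : ℝ) + 1) * L * ((2 * (d * L) + L + L : ℕ) : ℝ) + 102 * ((d : ℝ) + 1) ^ 2 * L * L)) * (η * w) + 1,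
    c3 d L / 4 / (η * (w + 1)), by positivity, by positivity, ?_⟩
  intro U hU ε hε hεmax hUε P hP
  have hPa : η * (NegSup.wInvSup (levWeight (L : ℝ) η lev₀ 1) * ‖P‖) ≤ c3 d L / 4 := by
    rw [← hwdef]
    have h1 : ‖P‖ ≤ c3 d L / 4 / (η * (w + 1)) := hP.le
    rw [le_div_iff₀ (by positivity)] at h1
    nlinarith [norm_nonneg P, mul_nonneg hη.le hw]
  refine (norm_Cc_sub_flat_le L m lev₀ lev₁ levB hL U hU hε hεmax hUε P hPa).trans ?_
  rw [← hwdef]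
  have hP0 := norm_nonneg P
  have hK0 : 0 ≤ (NegSup.wSup (levWeight (L : ℝ) η levB 0) : ℝ) *
      ((75497472 * ((d : ℝ) + 1) * L * ((2 * (d * L) + L + L : ℕ) : ℝ) + 102 * ((d : ℝ) + 1) ^ 2 * L * L)) * (η * w) := by positivity
  nlinarith [mul_nonneg hε hP0, hK0]

end Literature.MathematicalPhysics.QuantumFieldTheory.Balaban1983to89.B11Eq44COperatorModulus

end
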